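import Mathlib
import Summits.AtomisticToContinuum.Crystallization.Theorems.ChargedEnergyGap.Negative.Unconditional
import Summits.AtomisticToContinuum.Crystallization.Theorems.PalmUnimodularRigidityUnimodularEnergyLowerBoundCluster
import Literature.MathematicalPhysics.StatisticalMechanics.LennardJonesClusters
import HarnessLib

/-! # Good-centre selection (averaging + Chebyshev) — stub `stub_goodCentre` of line `Sketch`, crux `LjLaminarWindows` (stmt-AtomisticToContinuum-6711) -/

noncomputable section

open scoped BigOperators
open MeasureTheory Metric Filter Topology
open Literature.MathematicalPhysics.StatisticalMechanics
open Summit.AtomisticToContinuum.Crystallization.Theorems.ChargedEnergyGapNegative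

namespace Summit.AtomisticToContinuum.Crystallization.Theorems.LjLaminarWindowsSketch

/-- Real volume of a closed ball of radius `ρ ≥ 0` in `E3 = ℝ³`: `(4/3)·π·ρ³`. [folklore] -/
private theorem goodCentre_volumeReal_closedBall (x : E3) {ρ : ℝ} (hρ : 0 ≤ ρ) :
    volume.real (closedBall x ρ) = 4 / 3 * Real.pi * ρ ^ 3 := by
  rw [measureReal_def, EuclideanSpace.volume_closedBall_fin_three, ENNReal.toReal_mul,
    ENNReal.toReal_pow, ENNReal.toReal_ofReal hρ, ENNReal.toReal_ofReal (by positivity)]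
  ring

/-- The constant-`P` indicator of a closed ball in `E3` is integrable. [folklore] -/
private theorem goodCentre_integrable_indicator (x : E3) (ρ P : ℝ) :
    Integrable ((closedBall x ρ).indicator fun _ : E3 => P) := by
  refine IntegrableOn.integrable_indicator ?_ measurableSet_closedBall
  exact integrableOn_const (measure_closedBall_lt_top).ne

/-- **Good-centre selection (averaging + Chebyshev).** If an integrable `G ≥ -2εw` (with
`0 ≤ w ≤ P` integrable) has `∫ G ≤ -A < 0`, and the support of `w` inside a measurable set `D` is
covered by finitely many closed balls of total `P`-weighted volume `≤ A/(4ε)`, then `G` is negative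
at some point outside `D`. [folklore] -/
theorem goodCentre :
    ∀ (G w : E3 → ℝ) (D : Set E3) (N : ℕ) (s : Finset (Fin N)) (z : Fin N → E3) (r : Fin N → ℝ)
      (A ε P : ℝ), 0 < ε → 0 < A → 0 ≤ P → Integrable G → Integrable w →
      (∀ c, -(2 * ε * w c) ≤ G c) → (∀ c, 0 ≤ w c) → (∀ c, w c ≤ P) →
      (∫ c, G c) ≤ -A → MeasurableSet D →
      (∀ c ∈ D, w c ≠ 0 → ∃ m ∈ s, dist c (z m) ≤ r m) → (∀ m ∈ s, 0 ≤ r m) →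
      P * ∑ m ∈ s, (4 / 3 * Real.pi * (r m) ^ 3) ≤ A / (4 * ε) →
      ∃ c, c ∉ D ∧ G c < 0 := by
  intro G w D N s z r A ε P hε hA hP hG _hw hGw _hw0 hwP hint _hD hcover hr hsum
  by_contra h
  push Not at h
  -- `F` : the `P`-weighted sum of the indicators of the covering balls.
  set F : E3 → ℝ := fun c => ∑ m ∈ s, (closedBall (z m) (r m)).indicator (fun _ : E3 => P) c
    with hF
  have hFnn : ∀ c, 0 ≤ F c := fun c =>
    Finset.sum_nonneg fun m _ => Set.indicator_nonneg (fun _ _ => hP) _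
  have hFint : Integrable F :=
    integrable_finsetSum s fun m _ => goodCentre_integrable_indicator (z m) (r m) P
  -- Pointwise lower bound `G ≥ -2ε F`.
  have hGF : ∀ c, -(2 * ε) * F c ≤ G c := by
    intro c
    by_cases hcD : c ∈ D
    · by_cases hwc : w c = 0
      · have h1 := hGw c
        rw [hwc] at h1
        nlinarith [hFnn c]
      · obtain ⟨m, hm, hdist⟩ := hcover c hcD hwc
        have hPF : P ≤ F c := by
          calc P = (closedBall (z m) (r m)).indicator (fun _ : E3 => P) c := by
                rw [Set.indicator_of_mem (mem_closedBall.2 hdist)]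
            _ ≤ F c :=
                Finset.single_le_sum
                  (f := fun m => (closedBall (z m) (r m)).indicator (fun _ : E3 => P) c)
                  (fun m _ => Set.indicator_nonneg (fun _ _ => hP) _) hm
        nlinarith [hGw c, hwP c]
    · nlinarith [h c hcD, hFnn c]
  -- Integral of `F`.
  have hintF : ∫ c, F c = P * ∑ m ∈ s, (4 / 3 * Real.pi * (r m) ^ 3) := by
    rw [hF, integral_finsetSum s fun m _ => goodCentre_integrable_indicator (z m) (r m) P,
      Finset.mul_sum]
    refine Finset.sum_congr rfl fun m hm => ?_
    rw [integral_indicator_const P measurableSet_closedBall, smul_eq_mul,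
      goodCentre_volumeReal_closedBall (z m) (hr m hm)]
    ring
  -- Integrate the pointwise bound.
  have h1 : -(2 * ε) * (P * ∑ m ∈ s, (4 / 3 * Real.pi * (r m) ^ 3)) ≤ ∫ c, G c := by
    rw [← hintF, ← integral_const_mul]
    exact integral_mono (hFint.const_mul _) hG hGF
  have h2 : -(2 * ε) * (A / (4 * ε)) = -(A / 2) := by
    field_simp
    ring
  have h3 : -(2 * ε) * (P * ∑ m ∈ s, (4 / 3 * Real.pi * (r m) ^ 3)) ≥ -(2 * ε) * (A / (4 * ε)) :=
    mul_le_mul_of_nonpos_left hsum (by linarith)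
  linarith

end Summit.AtomisticToContinuum.Crystallization.Theorems.LjLaminarWindowsSketch

end
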